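import Summits.ResolutionOfSingularities.ResolutionOfSingularities.Theorems.SectionAscentFibrewiseClosedPointsTraceIdealColon
import Literature.AlgebraicGeometry.Resolution.BlowupsScaling
import Literature.AlgebraicGeometry.Resolution.BlowupsProduct
import Literature.AlgebraicGeometry.Resolution.AffineBlowupUniversal
import HarnessLib

/-!
# `FibrewiseClosedPoints` — support lemmas: the trace-ideal blow-up is `Bl_J` followed by the
blow-up of `((a):J)`, and `((a):J)` is principal wherever `J` is

Helper lemmas for crux `stmt-ResolutionOfSingularities-15960`
(`Summit.ResolutionOfSingularities.ResolutionOfSingularities.Theses.SectionAscent.FibrewiseClosedPoints`),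
continuing `…TraceIdeal.lean` (fact (A): `V(τ(J)) = Sing`) and `…TraceIdealColon.lean` (fact (B):
`(a)·τ(J) = J·((a):J)`) of the re-centering / trace-ideal-untwist mechanism
(`Cruxes/FibrewiseClosedPoints/ExactCentre.md`, idea `trace-ideal-untwist`), lead c2, 2026-08-17:

* `span_hom_ne_bot` — `τ(J) ≠ 0` for `J ≠ 0` (the inclusion `J → A` is a form).
* `isBlowup_comp_span_hom`, `isBlowup_comp_traceIdeal` — **Stacks 080A for the untwist**: if
  `p : X' → Spec A` is a blowing up along `J̃` and `p' : Y → X'` a blowing up along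
  `((a):J)~ · 𝒪_{X'}`, then `p' ≫ p` is a blowing up of `Spec A` along `τ(J)~` (tree:
  `IsBlowup.comp`, `affineBlowup.idealSheaf_mul`, `isBlowup_span_singleton_mul_iff`). So ANY
  principalization of `((a):J)·𝒪_{X'}` on the (regular) `X' = Bl_J` that is itself a blowing up
  presents `Bl_{τ(J)}`-dominating models as blowings up of `Spec A` with exact centre.
* `map_span_hom_eq_top_of_isPrincipal` — `τ(J) A_𝔭 = A_𝔭` where `J A_𝔭` is principal.
* `isPrincipal_map_colon_of_isPrincipal_map` — **`((a):J) A_𝔭` is principal wherever `J A_𝔭`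
  is** (localize (B): `(a) = (b)·((a):J)A_𝔭`, cancel `b`): the untwisting centre is invertible
  over the whole invertible locus of `J`, in particular (fact (A)'s hypothesis) over `Reg`.

## Sources
* The Stacks Project, Tags 080A, 0804. [StacksProject]
* J. Kollár, J. Witaszek, arXiv:2102.03162, Lemma 8. [KollarWitaszek2021]
-/

noncomputable section

set_option linter.dupNamespace false

open AlgebraicGeometry CategoryTheory Literature.AlgebraicGeometry.Resolution

namespace Summit.ResolutionOfSingularities.ResolutionOfSingularities.Theorems.SectionAscent.TraceIdeal

universe u

variable {A : Type u} [CommRing A]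

/-- `τ(J) ≠ 0` for a nonzero ideal `J`: the inclusion `J ↪ A` is a form taking the value `c` at
`c ∈ J`. [folklore] -/
theorem span_hom_ne_bot (J : Ideal A) (hJ : J ≠ ⊥) :
    Ideal.span {r : A | ∃ (φ : J →ₗ[A] A) (j : J), φ j = r} ≠ ⊥ := by
  obtain ⟨c, hcJ, hc0⟩ := J.ne_bot_iff.mp hJ
  intro h
  rw [Ideal.span_eq_bot] at h
  exact hc0 (h c ⟨J.subtype.restrictScalars A, ⟨c, hcJ⟩, rfl⟩)

/-- **The trace-ideal blowing up factors through `Bl_J`** (Stacks 080A applied to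
`(a)·τ(J) = J·((a):J)`): for a domain `A`, `0 ≠ a ∈ J`, a blowing up `p : X' → Spec A` along `J̃`
and a blowing up `p' : Y → X'` along `p⁻¹((a):J)~ · 𝒪_{X'}`, the composite `p' ≫ p` is a blowing
up of `Spec A` along `τ(J)~` — the factor `(a)` is invertible and does not change blowings up.
[cite: StacksProject, Tag 080A] -/
theorem isBlowup_comp_span_hom [IsDomain A] (J : Ideal A) {a : A} (haJ : a ∈ J) (ha0 : a ≠ 0)
    {X' Y : Scheme.{u}} {p : X' ⟶ Spec (.of A)} {p' : Y ⟶ X'}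
    (hp : IsBlowup p (affineBlowup.idealSheaf J))
    (hp' : IsBlowup p' ((affineBlowup.idealSheaf ((Ideal.span {a}).colon (J : Set A))).comap p)) :
    IsBlowup (p' ≫ p)
      (affineBlowup.idealSheaf (Ideal.span {r : A | ∃ (φ : J →ₗ[A] A) (j : J), φ j = r})) := by
  have hJ : J ≠ ⊥ := fun h => ha0 (by rw [h] at haJ; exact (Submodule.mem_bot A).mp haJ)
  have h := hp.comp hp'
  rw [← affineBlowup.idealSheaf_mul, ← span_singleton_mul_span_hom_eq J haJ ha0] at h
  exact (isBlowup_span_singleton_mul_iff (span_hom_ne_bot J hJ) ha0).mp h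

/-- **`τ(J) A_𝔭 = A_𝔭` where `J A_𝔭` is principal** (`A` Noetherian, `J` with a regular
element): some value `φ(j)` is a unit at `𝔭` (tree: `CechFiniteness.exists_hom_apply_not_mem`).
[cite: Lindo2017, §2] -/
theorem map_span_hom_eq_top_of_isPrincipal [IsNoetherianRing A] (J : Ideal A)
    (hreg : ∃ c ∈ J, c ∈ nonZeroDivisors A) (𝔭 : Ideal A) [𝔭.IsPrime]
    (hP : (J.map (algebraMap A (Localization.AtPrime 𝔭))).IsPrincipal) :
    (Ideal.span {r : A | ∃ (φ : J →ₗ[A] A) (j : J), φ j = r}).map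
      (algebraMap A (Localization.AtPrime 𝔭)) = ⊤ := by
  obtain ⟨φ, j, hj⟩ := Literature.RingTheory.LocalCohomology.exists_hom_apply_not_mem J hreg 𝔭 hP
  exact Ideal.eq_top_of_isUnit_mem _ (Ideal.mem_map_of_mem _ (Ideal.subset_span ⟨φ, j, rfl⟩))
    (IsLocalization.map_units (M := 𝔭.primeCompl) _ ⟨φ j, hj⟩)

/-- **The untwisting centre `((a):J)` is principal at `𝔭` whenever `J A_𝔭` is** (`A` a
Noetherian domain, `0 ≠ a ∈ J`): localizing `(a)·τ(J) = J·((a):J)` at `𝔭` gives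
`(a) = (b)·((a):J)A_𝔭` with `J A_𝔭 = (b)`, `b ≠ 0`, whence `((a):J)A_𝔭 = (a/b)`. Hence the
locus where `((a):J)·𝒪_{Bl_J}` fails to be invertible lies over the non-principal locus of `J`,
i.e. (fact (A)) over `Sing(Spec A)`. [cite: KollarWitaszek2021, Lemma 8] -/
theorem isPrincipal_map_colon_of_isPrincipal_map [IsDomain A] [IsNoetherianRing A] (J : Ideal A)
    {a : A} (haJ : a ∈ J) (ha0 : a ≠ 0) (𝔭 : Ideal A) [𝔭.IsPrime]
    (hP : (J.map (algebraMap A (Localization.AtPrime 𝔭))).IsPrincipal) :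
    (((Ideal.span {a}).colon (J : Set A)).map (algebraMap A (Localization.AtPrime 𝔭))).IsPrincipal := by
  set S := Localization.AtPrime 𝔭
  set M := (Ideal.span {a}).colon (J : Set A)
  have hreg : ∃ c ∈ J, c ∈ nonZeroDivisors A := ⟨a, haJ, mem_nonZeroDivisors_of_ne_zero ha0⟩
  obtain ⟨b, _, hb⟩ := exists_mem_map_eq_span J 𝔭 hP
  -- localize fact (B): `(a) = (b) · M A_𝔭`
  have hB := congrArg (Ideal.map (algebraMap A S)) (span_singleton_mul_span_hom_eq J haJ ha0)
  rw [Ideal.map_mul, Ideal.map_mul, map_span_hom_eq_top_of_isPrincipal J hreg 𝔭 hP, Ideal.mul_top,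
    hb, Ideal.map_span, Set.image_singleton] at hB
  -- `b ≠ 0` in `A_𝔭`
  have hb0 : algebraMap A S b ≠ 0 := by
    intro h0
    rw [h0, Ideal.span_singleton_eq_bot.mpr rfl, Ideal.bot_mul, Ideal.span_singleton_eq_bot] at hB
    exact ha0 (IsLocalization.injective S 𝔭.primeCompl_le_nonZeroDivisors (hB.trans (map_zero _).symm))
  -- `a = b c` with `c ∈ M A_𝔭`, and then `M A_𝔭 = (c)`
  have haM : algebraMap A S a ∈ Ideal.span {algebraMap A S b} * M.map (algebraMap A S) := by
    rw [← hB]; exact Ideal.mem_span_singleton_self _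
  obtain ⟨c, hcM, hc⟩ := Ideal.mem_span_singleton_mul.mp haM
  refine ⟨⟨c, le_antisymm ?_ ?_⟩⟩
  · intro m hm
    have : algebraMap A S b * m ∈ Ideal.span {algebraMap A S a} := by
      rw [hB]; exact Ideal.mul_mem_mul (Ideal.mem_span_singleton_self _) hm
    obtain ⟨r, hr⟩ := Ideal.mem_span_singleton'.mp this
    rw [← hc, ← mul_assoc, mul_comm r, mul_assoc] at hr
    have hm' : m = r * c := mul_left_cancel₀ hb0 hr.symm
    rw [Ideal.submodule_span_eq, hm']
    exact Ideal.mul_mem_left _ r (Ideal.mem_span_singleton_self c)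
  · rw [Ideal.submodule_span_eq, Ideal.span_le, Set.singleton_subset_iff]
    exact hcM

/-! ## Registered form (universe `0`, explicit binders) -/

/-- **Stacks 080A for the untwist** — registered helper of crux
`stmt-ResolutionOfSingularities-15960` (idea `trace-ideal-untwist`, stub name
`isBlowup_comp_traceIdeal`): for a domain `A : Type`, `0 ≠ a ∈ J`, a blowing up `p` of `Spec A`
along `J̃` and a blowing up `p'` of its source along `p⁻¹((a):J)~·𝒪`, the composite `p' ≫ p` is a
blowing up of `Spec A` along `τ(J)~`, `τ(J) = Σ_φ φ(J)`. [cite: StacksProject, Tag 080A] -/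
theorem isBlowup_comp_traceIdeal (A : Type) [CommRing A] [IsDomain A] (J : Ideal A) (a : A)
    (haJ : a ∈ J) (ha0 : a ≠ 0) (X' Y : AlgebraicGeometry.Scheme.{0})
    (p : X' ⟶ AlgebraicGeometry.Spec (CommRingCat.of A)) (p' : Y ⟶ X')
    (hp : Literature.AlgebraicGeometry.Resolution.IsBlowup p
    (Literature.AlgebraicGeometry.Resolution.affineBlowup.idealSheaf J))
    (hp' : Literature.AlgebraicGeometry.Resolution.IsBlowup p'
    ((Literature.AlgebraicGeometry.Resolution.affineBlowup.idealSheaf ((Ideal.span {a}).colon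
    (J : Set A))).comap p)) : Literature.AlgebraicGeometry.Resolution.IsBlowup (p' ≫ p)
    (Literature.AlgebraicGeometry.Resolution.affineBlowup.idealSheaf (Ideal.span {r : A | ∃
    (φ : J →ₗ[A] A) (j : J), φ j = r})) :=
  isBlowup_comp_span_hom J haJ ha0 hp hp'

end Summit.ResolutionOfSingularities.ResolutionOfSingularities.Theorems.SectionAscent.TraceIdeal

end
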